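import Summits.PneNP.PneNP.Theses.ConvexRankGates

/-!
# PneNP / ConvexRankGates — `ConvexGateBlind` from `CliqueExtLowerBound` (sub-basis glue)

Route `ConvexRankGates`, crux `ConvexGateBlind` (item `stmt-PneNP-10680`): no polynomial-size circuit
over `{∧₂, ∨₂} ∪ CONV_{m^c}` computes `CLIQUE(m, ⌈m^δ⌉₊)`. The route's crux #5 `CliqueExtLowerBound`
(item `stmt-PneNP-10682`) asserts the same over the FULL extended basis
`B_{m^c} = {∧₂, ∨₂} ∪ CONV_{m^c} ∪ PERM_{m^c} ∪ GRANK_{m^c}`; since the CONV sub-basis is contained in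
`B_s` (with the same `δ` and the same `c`), `CliqueExtLowerBound → ConvexGateBlind` by monotonicity of
`Circuit.IsOver` in the basis. This file records that implication (a `--supports` helper for
`stmt-PneNP-10680`; it closes nothing by itself). The two inlined `let`-bound gate classes are
syntactically different set-builder expressions, so the inclusion is checked disjunct by disjunct.
-/

namespace Summit.PneNP.PneNP.Theorems

open Filter

/-- **Crux #5 implies crux #2 in route ConvexRankGates.** If, for some `δ ∈ (0, 1/2)` and every `c`,
eventually no circuit with `≤ m^c` gates over the full extended monotone basis
`{∧₂, ∨₂} ∪ CONV_{m^c} ∪ PERM_{m^c} ∪ GRANK_{m^c}` computes `CLIQUE(m, ⌈m^δ⌉₊)`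
(`CliqueExtLowerBound`), then the same holds over the sub-basis `{∧₂, ∨₂} ∪ CONV_{m^c}`
(`ConvexGateBlind`), with the same `δ`: a circuit over the smaller basis is a circuit over the larger
one. [folklore] -/
theorem convexGateBlind_of_cliqueExtLowerBound
    (h : Summit.PneNP.PneNP.Theses.ConvexRankGates.CliqueExtLowerBound) :
    Summit.PneNP.PneNP.Theses.ConvexRankGates.ConvexGateBlind := by
  obtain ⟨δ, hδ0, hδ1, hlb⟩ := h
  refine ⟨δ, hδ0, hδ1, fun c => ?_⟩
  filter_upwards [hlb c] with m hm C hC hsize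
  refine hm C (fun g hg => ?_) hsize
  have hg' := hC g hg
  simp only [Set.mem_union, Set.mem_insert_iff, Set.mem_singleton_iff, Set.mem_setOf_eq] at hg' ⊢
  rcases hg' with (h | h) | ⟨p, q, hpq, rest⟩
  · exact Or.inl h
  · exact Or.inr (Or.inl h)
  · exact Or.inr (Or.inr (Or.inl ⟨p, q, hpq, rest⟩))

end Summit.PneNP.PneNP.Theorems
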